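import Summits.NavierStokesRegularity.NavierStokesRegularity.Theorems.FluidComputerReach

/-!
# Block line — the VARIABLE-TOLERANCE reach circuit: type, statics, guarded estimates

HONEST FRAMING: low prior, high value-of-information experiment on Tao's machine paradigm; NOT a
claim that NS blows up. Nothing here constructs a design or proves anything about Navier–Stokes: a
conservative GENERALISATION of the blueprint's reach layer (`Literature/…/ReachCircuit.lean`,
[cite: Tao2016AveragedNS, §1.3 pp. 10–11]) whose derived theory is re-proved verbatim.

WHY (`ASSEMBLY.md` §2g.9, `R1-DESIGN.md` §26). The lane's reach-layer no-go theorems against the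
open two-wavelet design (`BlockReachViscous`, `BlockReachProbe`, `BlockReachVoid`,
`BlockPairCeiling`) share ONE mechanism: on an amplitude-unbounded working region the
readout-velocity defect of a true trajectory is PROPORTIONAL TO THE AMPLITUDE (viscous decay
`-Λ_n a` of a clean loaded state; junk feedback `≍ jbar·κ·|z|`), while `ReachCircuit.defect` grants
a CONSTANT tolerance `ε`; bounded windows do not cure it, an AMPLITUDE-RELATIVE tolerance does. So
`ε` becomes a DEFECT MODULUS `ω n : O → ℝ` (e.g. `ε (1 + ‖z‖)`) in BOTH the idea-bound residue
`defect` (weaker) and the finite-dimensional certificate `cert` (stronger) — an honest exchange;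
regions, working region, field, modulus and tube are indexed by the generation, thresholds, leak
budget, cycle time and clock are not. `ReachCircuit` is the case `ω n z = ε`, all level-free.

WHAT IS PROVED ([folklore]; the proofs of `ReachCircuit.lean` §§2–4, index and modulus threaded
through). §1 the structure `VarReachCircuit S O s`; §2 statics (guard, classes `In n` / `Out n`,
SELF-REPLICATION `Out n ⊆ In (n+1)`, seed, clean states); §3 readout and junk along a trajectory;
§4 the GUARDED estimates `cert_of_guard`, `junk_toReal_le_of_guard`; the rest: `BlockVarCascade`.
RESTAGED (gen 38) with the EXPLICIT binder `(R : VarReachCircuit S O s)` on every declaration, so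
that no signature coincides textually with the `ReachCircuit` statics it generalises (another
structure, not importable instead); in §§3–4 the hypothesis `hu` now precedes `R` (`R.lemma hu …`).
-/

noncomputable section

open MeasureTheory Set Filter Topology
open scoped ENNReal NNReal SchwartzMap

namespace Summit.NavierStokesRegularity.FluidComputer

open Literature.Analysis.FluidPDE Literature.Analysis.FluidPDE.Tao2016
open Literature.Analysis.FluidPDE.FluidComputer
open Literature.Analysis.FunctionSpaces (eFourierSobolevNorm)

/-! ### §1. The structure -/

/-- **A circuit design with a certified reach–avoid tube and a VARIABLE defect tolerance** over the
spec sheet `S`, observable space `O`, junk measured in `X^s`, `s ≤ 10`. As `ReachCircuit` except: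
the admissible readout-velocity defect at readout `z` in generation `n` is a MODULUS `ω n z` in the
residue `defect` AND in the certificate `cert`, and regions, working region, field, modulus and
tube are indexed by the generation. Nothing asserts such a design exists. [cite: Tao2016AveragedNS, §1.3 pp. 10–11] -/
structure VarReachCircuit (S : CascadeSpecs) (O : Type*) [NormedAddCommGroup O] [NormedSpace ℝ O]
    (s : ℝ) where
  /-- READOUT / clean design state / junk size of generation `n` (as in `ReachCircuit`) -/
  read : ℕ → L2C → O
  recon : ℕ → O → L2C
  junk : ℕ → L2C → ℝ≥0∞
  /-- Lipschitz modulus of the readouts -/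
  Λ : ℝ
  Λ_pos : 0 < Λ
  /-- the readout of generation `n` is `Λ`-Lipschitz from `L²` measured in units of `√E_n` -/
  read_lip : ∀ (n : ℕ) (v w : L2C), dist (read n v) (read n w) * Real.sqrt (S.Emin n) ≤ Λ * ‖v - w‖
  /-- the junk functional of generation `n` is `1`-Lipschitz in `X^s` at scale `λ_n` -/
  junk_perturb : ∀ (n : ℕ) (v w : L2C), junk n w ≤ junk n v + scaledSobolevNorm s (S.lam n) (w - v)
  /-- the junk order is at most the regularity of the mild theory -/
  s_le_ten : s ≤ 10
  /-- design states read as designed -/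
  read_recon : ∀ (n : ℕ) (p : O), read n (recon n p) = p
  /-- design states carry no junk -/
  junk_recon : ∀ (n : ℕ) (p : O), junk n (recon n p) = 0
  /-- REGIONS (generation-indexed): admissible input / loaded-core / output readouts -/
  Ain : ℕ → Set O
  Acore : ℕ → Set O
  Aout : ℕ → Set O
  /-- thickness of the core inside the input region -/
  δ : ℝ
  δ_pos : 0 < δ
  core_thick : ∀ n, ∀ p ∈ Acore n, Metric.ball p δ ⊆ Ain n
  /-- junk thresholds (relative, in units of `√E_n`): core-loaded, loaded, running, ceiling -/
  (jcore jin jrun jbar : ℝ)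
  jcore_nonneg : 0 ≤ jcore
  jcore_lt : jcore < jin
  jrun_lt_jbar : jrun < jbar
  /-- STATICS (self-reproduction with erasure): read in `Aout n` at generation `n` with running junk
  ⇒ read in `Acore (n+1)` at generation `n+1` with core junk -/
  handoff : ∀ (n : ℕ) (v : L2C), read n v ∈ Aout n →
    junk n v ≤ ENNReal.ofReal (jrun * Real.sqrt (S.Emin n)) →
      read (n + 1) v ∈ Acore (n + 1) ∧
        junk (n + 1) v ≤ ENNReal.ofReal (jcore * Real.sqrt (S.Emin (n + 1)))
  /-- STATICS: loaded states of generation `n` carry energy `≥ E_n` at frequencies `|ξ| ≥ λ_n` -/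
  floor_cert : ∀ (n : ℕ) (v : L2C), read n v ∈ Ain n →
    junk n v ≤ ENNReal.ofReal (jin * Real.sqrt (S.Emin n)) →
      ENNReal.ofReal (S.Emin n) ≤ highFreqEnergy (S.lam n) v
  /-- CIRCUIT: the generation-`n` design vector field on `O` (rescaled time) -/
  F : ℕ → O → O
  /-- the open WORKING REGION of generation-`n` readouts on which the local estimates are claimed -/
  U : ℕ → Set O
  U_open : ∀ n, IsOpen (U n)
  /-- rescaled cycle time -/
  τc : ℝ
  τc_nonneg : 0 ≤ τc
  /-- DEFECT MODULUS: admissible readout-velocity defect per unit rescaled time at readout `z` in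
  generation `n` (the blueprint's constant `ε` is the special case `ω n z = ε`) -/
  ω : ℕ → O → ℝ
  /-- REACH TUBE: the readouts certified reachable at rescaled time `σ` from the input readout `p`
  by `ω`-approximate trajectories of `F n` inside `U n` -/
  Tube : ℕ → O → ℝ → Set O
  /-- the tube from an admissible input has closed graph over `[0, τc]` -/
  Tube_closed : ∀ n, ∀ p ∈ Ain n, IsClosed {z : ℝ × O | z.1 ∈ Icc 0 τc ∧ z.2 ∈ Tube n p z.1}
  /-- it starts at the input readout -/
  Tube_zero : ∀ n, ∀ p ∈ Ain n, p ∈ Tube n p 0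
  /-- AVOID: it lies in the working region for the whole cycle -/
  Tube_sub : ∀ n, ∀ p ∈ Ain n, ∀ σ ∈ Icc 0 τc, Tube n p σ ⊆ U n
  /-- CERTIFICATE (robust reach–avoid, finite-dimensional, variable tolerance): every continuous
  curve on `[0, σT]`, `σT ≤ τc`, from `p ∈ Ain n`, in `U n` on `[0, σT)` with right derivative
  within `ω n (x σ)` of `F n (x σ)` there, ends in `Tube n p σT`; if `σT = τc` it has visited `Aout n` -/
  cert : ∀ (n : ℕ), ∀ p ∈ Ain n, ∀ (σT : ℝ) (x : ℝ → O), 0 ≤ σT → σT ≤ τc → x 0 = p →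
    ContinuousOn x (Icc 0 σT) → (∀ σ ∈ Ico 0 σT, x σ ∈ U n) →
      (∀ σ ∈ Ico 0 σT, ∃ W : O, HasDerivWithinAt x W (Ici σ) σ ∧ ‖W - F n (x σ)‖ ≤ ω n (x σ)) →
        x σT ∈ Tube n p σT ∧ (σT = τc → ∃ σ ∈ Icc 0 τc, x σ ∈ Aout n)
  /-- LEAK BUDGET: junk growth rate `γ`; loaded junk plus one cycle of leakage is running junk -/
  γ : ℝ
  γ_nonneg : 0 ≤ γ
  jrun_ge : jin + γ * τc ≤ jrun
  /-- CLOCK: physical time per unit rescaled time at generation `n`; one cycle fits in `Tmax n` -/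
  unit : ℕ → ℝ
  unit_pos : ∀ n, 0 < unit n
  clock : ∀ n, unit n * τc ≤ S.Tmax n
  /-- DYNAMICS (idea-bound, local, guarded): READOUT DEFECT with variable tolerance — along every
  `H¹⁰_df`-mild Navier–Stokes trajectory, at every instant at which the state is in the
  generation-`n` working region, the readout has a right derivative whose rescaled value is within
  `ω n (readout)` of the design field -/
  defect : ∀ (n : ℕ) (a : L2C) (S' : ℝ) (u : ℝ → L2C), IsMildSolutionFor eulerForm a (Ico 0 S') u →
    ∀ t : ℝ, 0 ≤ t → t < S' → read n (u t) ∈ U n →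
      junk n (u t) < ENNReal.ofReal (jbar * Real.sqrt (S.Emin n)) →
        ∃ W : O, HasDerivWithinAt (fun t' => read n (u t')) W (Ici t) t ∧
          ‖unit n • W - F n (read n (u t))‖ ≤ ω n (read n (u t))
  /-- DYNAMICS (idea-bound, local, guarded): JUNK RATE — meanwhile the lower right Dini derivative
  of the generation-`n` junk is at most `γ √E_n / unit n` -/
  junk_rate : ∀ (n : ℕ) (a : L2C) (S' : ℝ) (u : ℝ → L2C),
    IsMildSolutionFor eulerForm a (Ico 0 S') u →
      ∀ t : ℝ, 0 ≤ t → t < S' → read n (u t) ∈ U n →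
        junk n (u t) < ENNReal.ofReal (jbar * Real.sqrt (S.Emin n)) →
          ∀ ρ : ℝ, γ < ρ → ∃ᶠ t' in 𝓝[>] t,
            junk n (u t') ≤ junk n (u t) + ENNReal.ofReal (ρ * Real.sqrt (S.Emin n) * ((t' - t) / unit n))
  /-- SEED: the ignition datum, read in the loaded core at generation `0` with core junk -/
  u₀ : 𝓢(EuclideanSpace ℝ (Fin 3), EuclideanSpace ℝ (Fin 3))
  divFree : VectorCalculus.IsDivFree ⇑u₀
  memH10df : MemH10df (schwartzL2 u₀)
  seed_read : read 0 (schwartzL2 u₀) ∈ Acore 0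
  seed_junk : junk 0 (schwartzL2 u₀) ≤ ENNReal.ofReal (jcore * Real.sqrt (S.Emin 0))

namespace VarReachCircuit

variable {S : CascadeSpecs} {O : Type*} [NormedAddCommGroup O] [NormedSpace ℝ O] {s : ℝ}

/-! ### §2. The working region, the thresholds, the input and output classes -/

/-- The generation-`n` **working region** guard: readout in `U n`, junk below `jbar √E_n`. [folklore] -/
def Guard (R : VarReachCircuit S O s) (n : ℕ) (v : L2C) : Prop :=
  R.read n v ∈ R.U n ∧ R.junk n v < ENNReal.ofReal (R.jbar * Real.sqrt (S.Emin n))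

/-- `jin ≤ jrun` (the leak over a cycle is nonnegative). [folklore] -/
theorem jin_le_jrun (R : VarReachCircuit S O s) : R.jin ≤ R.jrun :=
  (le_add_of_nonneg_right (mul_nonneg R.γ_nonneg R.τc_nonneg)).trans R.jrun_ge

/-- `0 < jbar` (`0 ≤ jcore < jin ≤ jrun < jbar`). [folklore] -/
theorem jbar_pos (R : VarReachCircuit S O s) : 0 < R.jbar :=
  ((R.jcore_nonneg.trans_lt R.jcore_lt).trans_le R.jin_le_jrun).trans R.jrun_lt_jbar

/-- Loaded junk plus leakage for rescaled time `σ ≤ τc` is at most running junk. [folklore] -/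
theorem jin_add_mul_le (R : VarReachCircuit S O s) {σ : ℝ} (hσ : σ ≤ R.τc) :
    R.jin + R.γ * σ ≤ R.jrun :=
  (add_le_add_right (mul_le_mul_of_nonneg_left hσ R.γ_nonneg) _).trans R.jrun_ge

/-- Read in the tube at `σ ≤ τc` with junk `≤ (jin + γ σ) √E_n` ⇒ in the working region. [folklore] -/
theorem guard_of_mem (R : VarReachCircuit S O s) (n : ℕ) {p : O} (hp : p ∈ R.Ain n) {σ : ℝ}
    (hσ : σ ∈ Icc 0 R.τc) {v : L2C} (hr : R.read n v ∈ R.Tube n p σ)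
    (hj : R.junk n v ≤ ENNReal.ofReal ((R.jin + R.γ * σ) * Real.sqrt (S.Emin n))) :
    R.Guard n v := by
  have hE : 0 < Real.sqrt (S.Emin n) := Real.sqrt_pos.2 (S.Emin_pos n)
  refine ⟨R.Tube_sub n p hp σ hσ hr, hj.trans_lt ?_⟩
  rw [ENNReal.ofReal_lt_ofReal_iff (mul_pos R.jbar_pos hE)]
  exact mul_lt_mul_of_pos_right ((R.jin_add_mul_le hσ.2).trans_lt R.jrun_lt_jbar) hE

/-- The readout of generation `n` is `(Λ/√E_n)`-Lipschitz from `L²`. [folklore] -/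
theorem dist_read_le (R : VarReachCircuit S O s) (n : ℕ) (v w : L2C) :
    dist (R.read n v) (R.read n w) ≤ R.Λ / Real.sqrt (S.Emin n) * ‖v - w‖ := by
  have hE : 0 < Real.sqrt (S.Emin n) := Real.sqrt_pos.2 (S.Emin_pos n)
  rw [div_mul_eq_mul_div, le_div_iff₀ hE]
  exact R.read_lip n v w

/-- The readout of generation `n` is continuous on `L²`. [folklore] -/
theorem read_continuous (R : VarReachCircuit S O s) (n : ℕ) : Continuous (R.read n) := by
  refine (LipschitzWith.of_dist_le' (K := R.Λ / Real.sqrt (S.Emin n)) fun v w => ?_).continuous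
  rw [dist_eq_norm v w]
  exact R.dist_read_le n v w

/-- Junk is `H¹⁰`-Lipschitz: `junk n w ≤ junk n v + C_n ‖w - v‖_{H¹⁰}` (`s ≤ 10`). [folklore] -/
theorem junk_le_junk_add (R : VarReachCircuit S O s) (n : ℕ) (v w : L2C) :
    R.junk n w ≤ R.junk n v + S.junkModulus n * eFourierSobolevNorm 10 (w - v) :=
  calc R.junk n w ≤ R.junk n v + scaledSobolevNorm s (S.lam n) (w - v) := R.junk_perturb n v w
    _ ≤ R.junk n v + scaledSobolevNorm 10 (S.lam n) (w - v) :=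
        add_le_add_right (scaledSobolevNorm_mono_order R.s_le_ten _ _) _
    _ ≤ R.junk n v + S.junkModulus n * eFourierSobolevNorm 10 (w - v) :=
        add_le_add_right (scaledSobolevNorm_le_mul_eFourierSobolevNorm (by norm_num) (S.lam_pos n) _) _

/-- The generation-`n` **input class**: read in `Ain n`, junk at most `jin √E_n`. [cite: Tao2016AveragedNS, §1.3 pp. 10–11] -/
def In (R : VarReachCircuit S O s) (n : ℕ) : Set L2C :=
  {v | R.read n v ∈ R.Ain n ∧ R.junk n v ≤ ENNReal.ofReal (R.jin * Real.sqrt (S.Emin n))}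

/-- The generation-`n` **output class**: read in the core of generation `n+1`, core junk. [cite: Tao2016AveragedNS, §1.3 pp. 10–11] -/
def Out (R : VarReachCircuit S O s) (n : ℕ) : Set L2C :=
  {v | R.read (n + 1) v ∈ R.Acore (n + 1) ∧
    R.junk (n + 1) v ≤ ENNReal.ofReal (R.jcore * Real.sqrt (S.Emin (n + 1)))}

/-- The loaded core lies in the input region, generation by generation. [folklore] -/
theorem Acore_subset_Ain (R : VarReachCircuit S O s) (n : ℕ) : R.Acore n ⊆ R.Ain n :=
  fun p hp => R.core_thick n p hp (Metric.mem_ball_self R.δ_pos)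

/-- Core junk is loaded junk: `jcore √E ≤ jin √E`. [folklore] -/
theorem ofReal_jcore_le (R : VarReachCircuit S O s) (n : ℕ) :
    ENNReal.ofReal (R.jcore * Real.sqrt (S.Emin n)) ≤
      ENNReal.ofReal (R.jin * Real.sqrt (S.Emin n)) :=
  ENNReal.ofReal_le_ofReal (mul_le_mul_of_nonneg_right R.jcore_lt.le (Real.sqrt_nonneg _))

/-- A state read in the core at generation `n` with core junk is a generation-`n` input state. [folklore] -/
theorem mem_In_of_core (R : VarReachCircuit S O s) {n : ℕ} {v : L2C} (hr : R.read n v ∈ R.Acore n)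
    (hj : R.junk n v ≤ ENNReal.ofReal (R.jcore * Real.sqrt (S.Emin n))) : v ∈ R.In n :=
  ⟨R.Acore_subset_Ain n hr, hj.trans (R.ofReal_jcore_le n)⟩

/-- **SELF-REPLICATION is a theorem of the design**: `Out n ⊆ In (n+1)`. [cite: Tao2016AveragedNS, §1.3 pp. 10–11] -/
theorem Out_subset_In (R : VarReachCircuit S O s) (n : ℕ) : R.Out n ⊆ R.In (n + 1) :=
  fun _ hv => R.mem_In_of_core hv.1 hv.2

/-- The seed is a generation-`0` input state. [folklore] -/
theorem seed_mem_In (R : VarReachCircuit S O s) : schwartzL2 R.u₀ ∈ R.In 0 :=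
  R.mem_In_of_core R.seed_read R.seed_junk

/-- Non-degeneracy: the clean design state with an admissible readout is an input state. [folklore] -/
theorem recon_mem_In (R : VarReachCircuit S O s) (n : ℕ) {p : O} (hp : p ∈ R.Ain n) :
    R.recon n p ∈ R.In n := by
  refine ⟨?_, ?_⟩
  · rw [R.read_recon]; exact hp
  · rw [R.junk_recon]; exact zero_le

/-- Non-degeneracy: the clean generation-`(n+1)` state with a core readout is an output. [folklore] -/
theorem recon_mem_Out (R : VarReachCircuit S O s) (n : ℕ) {p : O} (hp : p ∈ R.Acore (n + 1)) :
    R.recon (n + 1) p ∈ R.Out n := by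
  refine ⟨?_, ?_⟩
  · rw [R.read_recon]; exact hp
  · rw [R.junk_recon]; exact zero_le

/-- Loaded input readouts are in the working region at rescaled time `0` (`Tube_zero ⊆ U`). [folklore] -/
theorem Ain_subset_U (R : VarReachCircuit S O s) (n : ℕ) : R.Ain n ⊆ R.U n :=
  fun p hp => R.Tube_sub n p hp 0 ⟨le_rfl, R.τc_nonneg⟩ (R.Tube_zero n p hp)

/-! ### §3. Readout and junk ALONG a mild trajectory: finiteness and continuity -/

section Trajectory

variable {a : L2C} {S' : ℝ} {u : ℝ → L2C} (hu : IsMildSolutionFor eulerForm a (Ico 0 S') u)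
include hu

/-- Junk finite at one instant of a mild trajectory is finite at every instant. [folklore] -/
theorem junk_ne_top (R : VarReachCircuit S O s) (n : ℕ) {t : ℝ} (ht : t ∈ Ico 0 S')
    (hfin : R.junk n (u t) ≠ ⊤) {x : ℝ} (hx : x ∈ Ico 0 S') : R.junk n (u x) ≠ ⊤ :=
  ne_top_of_le_ne_top (ENNReal.add_ne_top.2 ⟨hfin, ENNReal.mul_ne_top (S.junkModulus_ne_top n)
    (LocalCircuit.eFourierSobolevNorm_sub_lt_top hu hx ht).ne⟩) (R.junk_le_junk_add n (u t) (u x))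

/-- Junk is continuous along a mild trajectory (where finite). [folklore] -/
theorem junk_tendsto (R : VarReachCircuit S O s) (n : ℕ) {x : ℝ} (hx : x ∈ Ico 0 S')
    (hfin : R.junk n (u x) ≠ ⊤) :
    Tendsto (fun y => R.junk n (u y)) (𝓝[Ico 0 S'] x) (𝓝 (R.junk n (u x))) := by
  have hQ : Tendsto (fun y => S.junkModulus n * eFourierSobolevNorm 10 (u y - u x))
      (𝓝[Ico 0 S'] x) (𝓝 0) := by
    have h := ENNReal.Tendsto.const_mul (hu.2.1 x hx) (Or.inr (S.junkModulus_ne_top n))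
    rwa [mul_zero] at h
  rw [ENNReal.tendsto_nhds hfin]
  intro e he
  filter_upwards [(tendsto_order.1 hQ).2 e he] with y hy
  refine ⟨tsub_le_iff_right.2 ?_, ?_⟩
  · calc R.junk n (u x) ≤ R.junk n (u y) + S.junkModulus n * eFourierSobolevNorm 10 (u x - u y) :=
          R.junk_le_junk_add n (u y) (u x)
      _ = R.junk n (u y) + S.junkModulus n * eFourierSobolevNorm 10 (u y - u x) := by
          rw [eFourierSobolevNorm_sub_comm]
      _ ≤ R.junk n (u y) + e := add_le_add_right hy.le _
  · calc R.junk n (u y) ≤ R.junk n (u x) + S.junkModulus n * eFourierSobolevNorm 10 (u y - u x) :=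
          R.junk_le_junk_add n (u x) (u y)
      _ ≤ R.junk n (u x) + e := add_le_add_right hy.le _

/-- The real-valued junk is continuous along a mild trajectory (where finite). [folklore] -/
theorem junk_toReal_continuousWithinAt (R : VarReachCircuit S O s) (n : ℕ) {x : ℝ}
    (hx : x ∈ Ico 0 S') (hfin : R.junk n (u x) ≠ ⊤) :
    ContinuousWithinAt (fun y => (R.junk n (u y)).toReal) (Ico 0 S') x :=
  (ENNReal.tendsto_toReal hfin).comp (R.junk_tendsto hu n hx hfin)

/-- The readout is continuous along a mild trajectory. [folklore] -/
theorem read_continuousOn (R : VarReachCircuit S O s) (n : ℕ) :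
    ContinuousOn (fun y => R.read n (u y)) (Ico 0 S') :=
  (R.read_continuous n).comp_continuousOn hu.2.1.continuousOn

/-! ### §4. The two GUARDED estimates: the certificate applies, and the Dini fence -/

/-- **THE CERTIFICATE APPLIES TO THE TRUE READOUT (guarded).** Along a mild trajectory read in
`Ain n` at time `t ≥ 0` that stays in the generation-`n` working region for physical times
`[t, t + unit n · σT)`, `0 ≤ σT ≤ τc`, the readout at `t + unit n · σT` lies in
`Tube n (read n (u t)) σT`, and if `σT = τc` it has visited `Aout n` (`defect` + `cert`). [folklore] -/
theorem cert_of_guard (R : VarReachCircuit S O s) (n : ℕ) {t : ℝ} (ht : 0 ≤ t)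
    (hin : R.read n (u t) ∈ R.Ain n) {σT : ℝ} (hσT0 : 0 ≤ σT) (hσT : σT ≤ R.τc)
    (hS' : t + R.unit n * σT < S')
    (hG : ∀ x ∈ Ico t (t + R.unit n * σT), R.Guard n (u x)) :
    R.read n (u (t + R.unit n * σT)) ∈ R.Tube n (R.read n (u t)) σT ∧
      (σT = R.τc → ∃ σ ∈ Icc 0 R.τc, R.read n (u (t + R.unit n * σ)) ∈ R.Aout n) := by
  have hun := R.unit_pos n
  have hphys : ∀ σ ∈ Ico 0 σT, t + R.unit n * σ ∈ Ico t (t + R.unit n * σT) := fun σ hσ =>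
    ⟨le_add_of_nonneg_right (mul_nonneg hun.le hσ.1),
      add_lt_add_right (mul_lt_mul_of_pos_left hσ.2 hun) t⟩
  have hphys' : ∀ σ ∈ Ico 0 σT, 0 ≤ t + R.unit n * σ ∧ t + R.unit n * σ < S' := fun σ hσ =>
    ⟨ht.trans (hphys σ hσ).1, (hphys σ hσ).2.trans hS'⟩
  have hW : ∀ σ ∈ Ico 0 σT, ∃ W : O,
      HasDerivWithinAt (fun t' => R.read n (u t')) W (Ici (t + R.unit n * σ)) (t + R.unit n * σ) ∧
        ‖R.unit n • W - R.F n (R.read n (u (t + R.unit n * σ)))‖ ≤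
          R.ω n (R.read n (u (t + R.unit n * σ))) := fun σ hσ =>
    R.defect n a S' u hu _ (hphys' σ hσ).1 (hphys' σ hσ).2 (hG _ (hphys σ hσ)).1
      (hG _ (hphys σ hσ)).2
  choose! W hW using hW
  have hcont : ContinuousOn (fun σ => R.read n (u (t + R.unit n * σ))) (Icc 0 σT) := by
    refine (R.read_continuousOn hu n).comp (by fun_prop) fun σ hσ => ⟨?_, ?_⟩
    · exact add_nonneg ht (mul_nonneg hun.le hσ.1)
    · exact (add_le_add_right (mul_le_mul_of_nonneg_left hσ.2 hun.le) t).trans_lt hS'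
  have hderiv : ∀ σ ∈ Ico 0 σT, HasDerivWithinAt (fun σ => R.read n (u (t + R.unit n * σ)))
      (R.unit n • W σ) (Ici σ) σ := by
    intro σ hσ
    have hh : HasDerivWithinAt (fun z : ℝ => t + R.unit n * z) (R.unit n) (Ici σ) σ := by
      simpa using ((hasDerivWithinAt_id σ (Ici σ)).const_mul (R.unit n)).const_add t
    exact (hW σ hσ).1.scomp σ hh fun z hz => add_le_add_right (mul_le_mul_of_nonneg_left hz hun.le) t
  have h0 : (fun σ => R.read n (u (t + R.unit n * σ))) 0 = R.read n (u t) := by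
    simp only [mul_zero, add_zero]
  exact R.cert n (R.read n (u t)) hin σT (fun σ => R.read n (u (t + R.unit n * σ))) hσT0 hσT h0
    hcont (fun σ hσ => (hG _ (hphys σ hσ)).1)
    (fun σ hσ => ⟨R.unit n • W σ, hderiv σ hσ, (hW σ hσ).2⟩)

/-- **GUARDED LEAKAGE** (Dini fence): with finite junk at `t ≥ 0`, while the state stays in the
working region on `[t, T)`, `T < S'`, the junk grows at most at rate `γ √E_n / unit n`. [folklore] -/
theorem junk_toReal_le_of_guard (R : VarReachCircuit S O s) (n : ℕ) {t T : ℝ} (ht : 0 ≤ t)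
    (hT : T < S') (hfin : R.junk n (u t) ≠ ⊤) (hG : ∀ x ∈ Ico t T, R.Guard n (u x)) :
    ∀ x ∈ Icc t T, (R.junk n (u x)).toReal ≤
      (R.junk n (u t)).toReal + R.γ * (Real.sqrt (S.Emin n) / R.unit n) * (x - t) := by
  intro x hx
  have htT : t ≤ T := hx.1.trans hx.2
  have hun := R.unit_pos n
  have hE : 0 < Real.sqrt (S.Emin n) := Real.sqrt_pos.2 (S.Emin_pos n)
  set c : ℝ := Real.sqrt (S.Emin n) / R.unit n with hc
  have hc0 : 0 < c := div_pos hE hun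
  have hI : Icc t T ⊆ Ico 0 S' := fun y hy => ⟨ht.trans hy.1, hy.2.trans_lt hT⟩
  set J : ℝ → ℝ := fun y => (R.junk n (u y)).toReal with hJ
  have hJc : ContinuousOn J (Icc t T) := fun y hy =>
    (R.junk_toReal_continuousWithinAt hu n (hI hy)
      (R.junk_ne_top hu n (hI ⟨le_rfl, htT⟩) hfin (hI hy))).mono hI
  have key : ∀ ρ, R.γ < ρ → J x ≤ J t + ρ * c * (x - t) := by
    intro ρ hρ
    refine image_le_of_liminf_slope_right_lt_deriv_boundary' (f := J) (f' := fun _ => R.γ * c)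
      (a := t) (b := T) hJc ?_ (B := fun y => J t + ρ * c * (y - t)) (B' := fun _ => ρ * c)
      (by simp) (by fun_prop) ?_ (fun _ _ _ => mul_lt_mul_of_pos_right hρ hc0) hx
    · intro y hy r hr
      obtain ⟨r', hr'1, hr'2⟩ := exists_between hr
      have hr'0 : 0 < r' := (mul_nonneg R.γ_nonneg hc0.le).trans_lt hr'1
      have hρ' : R.γ < r' / c := by rwa [lt_div_iff₀ hc0]
      have hy0 : 0 ≤ y := ht.trans hy.1
      have hyS : y < S' := hy.2.trans hT
      have hfreq := R.junk_rate n a S' u hu y hy0 hyS (hG y hy).1 (hG y hy).2 (r' / c) hρ'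
      have hev : ∀ᶠ z in 𝓝[>] y, y < z := eventually_nhdsWithin_of_forall fun z hz => hz
      refine (hfreq.and_eventually hev).mono fun z hz => ?_
      obtain ⟨hz, hyz⟩ := hz
      have hyfin : R.junk n (u y) ≠ ⊤ := (hG y hy).2.ne_top
      have hq : 0 ≤ r' / c * Real.sqrt (S.Emin n) * ((z - y) / R.unit n) :=
        mul_nonneg (mul_nonneg (div_nonneg hr'0.le hc0.le) hE.le)
          (div_nonneg (sub_nonneg.2 hyz.le) hun.le)
      have hcc : r' / c * Real.sqrt (S.Emin n) * ((z - y) / R.unit n) = r' * (z - y) := by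
        rw [hc]; field_simp
      have hJz : J z ≤ J y + r' * (z - y) := by
        have h1 := ENNReal.toReal_mono (ENNReal.add_ne_top.2 ⟨hyfin, ENNReal.ofReal_ne_top⟩) hz
        rw [ENNReal.toReal_add hyfin ENNReal.ofReal_ne_top, ENNReal.toReal_ofReal hq, hcc] at h1
        exact h1
      rw [slope_def_field]
      calc (J z - J y) / (z - y) ≤ r' := by rw [div_le_iff₀ (sub_pos.2 hyz)]; linarith
        _ < r := hr'2
    · intro y _
      have h := (((hasDerivWithinAt_id y (Ici y)).sub_const t).const_mul (ρ * c)).const_add (J t)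
      simpa using h
  have htend : Tendsto (fun ρ => J t + ρ * c * (x - t)) (𝓝[>] R.γ)
      (𝓝 (J t + R.γ * c * (x - t))) :=
    ((by fun_prop : Continuous fun ρ : ℝ => J t + ρ * c * (x - t)).tendsto R.γ).mono_left
      nhdsWithin_le_nhds
  exact ge_of_tendsto htend (eventually_nhdsWithin_of_forall fun ρ hρ => key ρ hρ)

end Trajectory

end VarReachCircuit

end Summit.NavierStokesRegularity.FluidComputer
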